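import Summits.CriticalPhenomena.CardyFormulaZ2.Theses.CardyLeeYang
import Summits.CriticalPhenomena.CardyFormulaZ2.Theses.CardyPolygonWords
import Summits.CriticalPhenomena.CardyFormulaZ2.Theorems.CardyPolygonWordsAssembly
import Literature.Probability.RandomPlanarGeometry.KlebanZagierTheorem2
import HarnessLib

/-!
# Birth skeleton `Lines/birth.lean` for the crux `CardyLeeYang.StieltjesIdentification`
(item `stmt-CriticalPhenomena-16788`, rank-3 crux of route `route-CriticalPhenomena-CardyLeeYang`,
sub-problem `CardyFormulaZ2`; BC3 skeleton registered by the skeleton registrar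
`skel-stmt-CriticalPhenomena-16788`, 2026-08-17)

The crux, verbatim: IF for every conformal rectangle `R` and every mesh sequence `s → 0⁺` there is a
subsequence along which the law of the crossing NUMBER `N_R^δ` (number of open clusters of the G02
discretisation `Ω_δ` meeting both discrete arcs `(ab)_δ`, `(cd)_δ`) converges, coefficient by
coefficient, to a Poisson-binomial law `PB(p)` with `Σ pᵢ < ∞` (the conclusion of the support
`PoissonBinomialLimits`; below `H_PB`), THEN Cardy's formula
`R.HasCrossingLimit (bondDomainCrossingProb R) cardyFunction` holds for every conformal rectangle whose
boundary is covered by finitely many axis-parallel segments (rectilinear `R`, marks anywhere).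

## The line (the crux's own declared mechanism): scaling function of the aspect ratio under `H_PB`
## ⟶ self-duality + conformal-block (two-channel) structure ⟶ Kleban–Zagier rigidity (Theorem 2,
## corrected — PROVED in the tree) ⟶ Cardy on corner-marked rectangles ⟶ lattice polygons by
## junctions ⟶ every (rectilinear) conformal rectangle by the tree's PROVED polygon density theorem

Docstring of the crux: "identify the Stieltjes measure of each limit via the two-channel structure of
`Φ(r,y)` on lattice rectangles … a Kleban–Zagier-type rigidity with a fugacity, then corners/polygons
by the tree's rectilinear technology". Write
`LR(a,b,δ) := discreteCrossingProb half (0,a)×(0,b) δ {re z = 0, 0 ≤ im z ≤ b} {re z = a, 0 ≤ im z ≤ b}`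
(left-to-right crossing of the G02-discretised open box between its closed vertical sides; at
`y = 0` the crossing-number PGF `Φ_{a/b}(y) = E[y^N]` of the route is `1 − LR` in the limit, and the
Poisson-binomial structure says `1 − P(r) = Π_i (1 − p_i(r))`, an Euler product).

* `stub_scalingLimitPB` (OPEN; XL) — under `H_PB` the scaling function exists: there is `P : ℝ → ℝ`
  with `LR(a,b,δ) → P(a/b)` as `δ → 0⁺` for all `a, b > 0`. `H_PB` makes every subsequential limit law
  of `N` Poisson-binomial; the existence of the full limit of `P(N ≥ 1)` is the uniqueness half of the
  identification (on bare `ℤ²` this is the classical open core, cf. the UNCONDITIONAL stub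
  `stub_scalingLimit` registered on the shared item `CardyPolygonWords.CardyRectangle`, stmt-4782).
* `stub_selfDualBlockPB` (OPEN; XL; load-bearing) — under `H_PB`, ANY such scaling function is
  self-dual, `P(1/r) = 1 − P(r)` (planar duality at `p = 1/2` + transposition + `O(δ)`-insensitivity;
  provable from the hypothesis with tree RSW technology), and is a Kleban–Zagier conformal block of
  some dimension `α > 0` with polynomially bounded coefficients, `P(r) = Σₙ cₙ e^{−π r (n+α)}` — the
  closed-channel tower structure `Σ_j B_j(0) e^{−π r x_j(0)}` of the crux text. This is where the
  Lee–Yang input is meant to bite: the two-boundary Temperley–Lieb transfer matrix in the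
  doubly-touching fugacity `y` has `E[y^N]` as a matrix element, `H_PB`/PTAR give zero-free PGFs
  uniformly in the size (Hurwitz), and the block form at `y = 0` is the `y → 0` member of an analytic
  family (`StripPressureScaling` is its pressure-level checkpoint).
* `stub_boundaryDimension` (OPEN; L–XL) — in any conformal-block representation with `α > 0` of such a
  scaling function, `α = 1/3`: the `π/3`-law `−log P(r) ∼ π r/3` (`π h_{1,3}`; in this route
  `Ψ(0) = −π/3`, the one-cluster Kac rate of `StripClusterRates`). VERBATIM the registered stub
  `stub_dimension` of the shared item stmt-4782 (`Cruxes/CardyRectangle/Lines/birth.lean`): one proof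
  closes both.
* `stub_cornerMarkings` (provable now; M–L) — GEOMETRY/LATTICE bookkeeping: if a scaling function `P`
  exists and `P(r) = F(λ(ir))` (`cardyFunction (lamR r)`) for `r > 0`, then `CardyRectangle` (Cardy for
  every open box `(0,a)×(0,b)` with its four corners marked, all eight markings): arcs `0`/`2` are a pair
  of opposite closed sides (`arc i = boundary '' [mark i, nextMark i]`), the modulus of a corner-marked
  rectangle is `λ(i·a/b)` resp. `λ(i·b/a)` (`rectangle_crossRatio_eq_lamR`, `crossRatio_neg/_rev`,
  `crossRatio_eq_of_isUniformizing`), the bottom-to-top crossing probability of the box `(0,a)×(0,b)`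
  is `LR(b,a,δ)` (transposition automorphism of `ℤ²` through `meshDomain`/`discreteArc`/
  `bondPercolation`), and the crossing event is symmetric in the two arcs.
* `stub_junctionsPB` (OPEN; XL) — POLYGONS BY JUNCTIONS: under `H_PB`, Cardy for corner-marked
  rectangles implies Cardy for every LATTICE polygon with lattice marks (`CardyLatticePolygon` of
  route CardyPolygonWords, stmt-4781): the transfer-matrix word of a polyomino (rectangle data + junction
  letters; "corner operators of polygons" in the crux's NOT-DECOMPOSED list), with the Poisson-binomial
  structure of the crossing number available on every polygon (`H_PB` quantifies over all conformal
  rectangles). Compare the sibling obligation `WordSewing : CardyRectangle → CardyOneStep →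
  CardyLatticePolygon` (stmt-14409), which trades `H_PB` for the one-step datum.

Composition `StieltjesIdentification_of` (REAL proof, no `sorry`): from `H_PB`, stub 1 gives `P`, stub 2
its duality and block data, so `P(1) = 1/2` and `P → 0` at `∞` (`KlebanZagier.tendsto_P_atTop`): `P` is
not constant and `KlebanZagier.theorem2_corrected` (Kleban–Zagier 2003 §5 Thm 2 with the missing
non-constancy hypothesis, PROVED in `KlebanZagierTheorem2.lean`) gives
`P = genCardyFunction α ∘ modularLambdaI` on `(0,∞)`; stub 3 pins `α = 1/3`,
`genCardyFunction (1/3) = cardyFunction` (`Γ(4/3) = Γ(1/3)/3`, proved below) and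
`modularLambdaI = lamR` give `P(r) = F(λ(ir))`; stub 4 turns this into `CardyRectangle`, stub 5 (with
`H_PB`) into `CardyLatticePolygon`, and the tree's PROVED polygon density theorem
`Theorems.LatticePolygonApproximation.cardyFormulaZ2_of_cardyLatticePolygon` (Bollobás–Riordan sandwich
with lattice-polygon approximants, Radó continuity, RSW; item stmt-4784 closed 2026-08-16) gives Cardy's
formula for every conformal rectangle, in particular for the rectilinear ones of the crux's conclusion
(the rectilinearity witness is not needed — exactly as `RectilinearSuffices`, stmt-5663/16791, is proved).

Device (D-0027 §3.3, as in `Cruxes/CardyRectangle/Lines/birth.lean`): each stub is a sorried theorem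
`Holds.stub_<name> : <full statement over tree declarations>` (registered under the short name
`stub_<name>` with that text) plus the by-name handle `def stub_<name> : Prop := type_of% Holds.stub_<name>`;
the hypotheses of `StieltjesIdentification_of` are exactly the five handles, and
`StieltjesIdentification_proof` applies it to the five sorried stubs (certifying mechanically that the
handles ARE the stub statements). Sorries: exactly the five `Holds.stub_*`; nothing else.

Disproof used: none — no `Disproof.lean`, no `Negative/` lemma and no other workfile exists for this
crux at registration (`ledger crux ls stmt-CriticalPhenomena-16788`: "(no workfiles yet)", 2026-08-17;
item evidence empty). The summit's negatives index has no statement about rectangle scaling functions,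
conformal blocks, crossing numbers or lattice polygons (the three refuted Cardy statements stmt-8581 /
stmt-0748 / stmt-6949 concern junction shadowing, degenerate arcs and dual-current templates). The
literal Kleban–Zagier Theorem 2 is refuted in the tree (`KlebanZagier.theorem2_false`, constant block
`1/2`); the composition uses the corrected theorem and DERIVES its non-constancy hypothesis. No stub is a
restatement: stubs 1–3 speak about ONE real function of the aspect ratio, stub 4 contains no limit
hypothesis beyond that function, stub 5 needs Cardy on rectangles as INPUT; `stub → StieltjesIdentification`
and `stub → CardyFormulaZ2` fail the cheap probes for all five (BC3, see `Lines/birth.md`).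
-/

noncomputable section

namespace Summit.CriticalPhenomena.CardyFormulaZ2.Cruxes.StieltjesIdentification.Birth

open Set Filter Topology
open scoped BigOperators
open Literature.Probability.RandomPlanarGeometry
open Literature.Probability.RandomPlanarGeometry.KlebanZagier (IsConformalBlock lamR modularLambdaI
  genCardyFunction)
open Literature.Probability.Percolation (bondDomainCrossingProb discreteCrossingProb half)
open Summit.CriticalPhenomena.CardyFormulaZ2.Theses.CardyLeeYang (StieltjesIdentification)
open Summit.CriticalPhenomena.CardyFormulaZ2.Theses.CardyPolygonWords (CardyRectangle CardyLatticePolygon)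

/-! ### The five registered stubs (the ONLY `sorry`s of this file) and their by-name handles -/

/-- **Stub 1 — existence of the scaling function of the aspect ratio under `H_PB` (OPEN; XL).** If
every mesh sequence of every conformal rectangle has a subsequence along which the crossing-number law
converges to a summable Poisson-binomial law (`H_PB`, the antecedent of the crux), then there is
`P : ℝ → ℝ` such that for all `a, b > 0` the left-to-right crossing probability of the G02-discretised
box `(0,a)×(0,b)` (closed vertical sides as arcs) tends to `P (a/b)` as the mesh `δ → 0⁺`
(uniqueness of the subsequential limits; Cardy 1992; Langlands–Pouliot–Saint-Aubin 1994; open on `ℤ²`,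
Schramm ICM 2006 Problem 2.11). -/
protected theorem Holds.stub_scalingLimitPB : (∀ (R : Literature.Probability.RandomPlanarGeometry.ConformalRectangle) (s : ℕ → ℝ), (∀ j, 0 < s j) → Filter.Tendsto s Filter.atTop (nhds 0) → let G : ℝ → Literature.Probability.Percolation.BondConfig (Literature.Probability.LatticeModels.Site 2) → SimpleGraph (Literature.Probability.LatticeModels.Site 2) := fun δ ω => Literature.Probability.Percolation.openGraph ω ⊓ Literature.Probability.LatticeModels.discreteDomainGraph R.carrier δ; let atLeast : ℝ → ℕ → Set (Literature.Probability.Percolation.BondConfig (Literature.Probability.LatticeModels.Site 2)) := fun δ k => {ω | ∃ x : Fin k → Literature.Probability.LatticeModels.Site 2, (∀ i, x i ∈ Literature.Probability.LatticeModels.discreteArc R.carrier δ (R.arc 0) ∧ ∃ y ∈ Literature.Probability.LatticeModels.discreteArc R.carrier δ (R.arc 2), (G δ ω).Reachable (x i) y) ∧ ∀ i j, i ≠ j → ¬ (G δ ω).Reachable (x i) (x j)}; ∃ φ : ℕ → ℕ, StrictMono φ ∧ ∃ (p r : ℕ → ℝ), (∀ i, 0 ≤ p i ∧ p i ≤ 1)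 ∧ Summable p ∧ (∀ k : ℕ, Filter.Tendsto (fun n : ℕ => (∏ i ∈ Finset.range n, (Polynomial.C (1 - p i) + Polynomial.C (p i) * Polynomial.X)).coeff k) Filter.atTop (nhds (r k))) ∧ ∀ k : ℕ, Filter.Tendsto (fun j : ℕ => (Literature.Probability.Percolation.bondPercolation (Literature.Probability.LatticeModels.zdGraph 2) Literature.Probability.Percolation.half).real (atLeast (s (φ j)) k) - (Literature.Probability.Percolation.bondPercolation (Literature.Probability.LatticeModels.zdGraph 2) Literature.Probability.Percolation.half).real (atLeast (s (φ j)) (k + 1))) Filter.atTop (nhds (r k))) → ∃ P : ℝ → ℝ, ∀ a b : ℝ, 0 < a → 0 < b → Filter.Tendsto (fun δ : ℝ => Literature.Probability.Percolation.discreteCrossingProb Literature.Probability.Percolation.half {z : ℂ | 0 < z.re ∧ z.re < a ∧ 0 < z.im ∧ z.im < b} δ {z : ℂ | z.re = 0 ∧ 0 ≤ z.im ∧ z.im ≤ b} {z : ℂ | z.re = a ∧ 0 ≤ z.im ∧ z.im ≤ b}) (nhdsWithin 0 (Set.Ioi 0)) (nhds (P (a / b))) := by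
  sorry

/-- By-name handle of the registered stub `Holds.stub_scalingLimitPB`. -/
def stub_scalingLimitPB : Prop := type_of% Holds.stub_scalingLimitPB

/-- **Stub 2 — self-duality and conformal-block (two-channel tower) structure of the scaling
function under `H_PB` (OPEN; XL; the load-bearing stub).** Under `H_PB`, any scaling function `P` of
stub 1 satisfies `P (1/r) = 1 − P r` for `r > 0` (planar duality at the self-dual point, Grimmett 1999
§11.2; transposition; `O(δ)`-insensitivity by monotonicity in the box and RSW quad-continuity,
Schramm–Smirnov 2011 §5) and is a Kleban–Zagier conformal block of some dimension `α > 0` with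
coefficients of polynomial growth, `P(r) = Σₙ cₙ e^{−π r (n+α)}`, `c₀ ≠ 0`, `|cₙ| ≤ C (n+1)^k`
(Kleban–Zagier 2003 §5, hypotheses (i′) of Theorem 2; lattice side: the two-boundary Temperley–Lieb
transfer matrix of the strip in the doubly-touching fugacity `y`, `E[y^N]` a matrix element, zero-free
PGFs uniformly in the size from PTAR/`H_PB`, closed-channel towers `x_j(0)`; Dubail–Jacobsen–Saleur
2008 §3–5, de Gier–Nichols 2009). -/
protected theorem Holds.stub_selfDualBlockPB : (∀ (R : Literature.Probability.RandomPlanarGeometry.ConformalRectangle) (s : ℕ → ℝ), (∀ j, 0 < s j) → Filter.Tendsto s Filter.atTop (nhds 0) → let G : ℝ → Literature.Probability.Percolation.BondConfig (Literature.Probability.LatticeModels.Site 2) → SimpleGraph (Literature.Probability.LatticeModels.Site 2) := fun δ ω => Literature.Probability.Percolation.openGraph ω ⊓ Literature.Probability.LatticeModels.discreteDomainGraph R.carrier δ; let atLeast : ℝ → ℕ → Set (Literature.Probability.Percolation.BondConfig (Literature.Probability.LatticeModels.Site 2)) := fun δ k => {ω | ∃ x : Fin k → Literature.Probability.LatticeModels.Site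 2, (∀ i, x i ∈ Literature.Probability.LatticeModels.discreteArc R.carrier δ (R.arc 0) ∧ ∃ y ∈ Literature.Probability.LatticeModels.discreteArc R.carrier δ (R.arc 2), (G δ ω).Reachable (x i) y) ∧ ∀ i j, i ≠ j → ¬ (G δ ω).Reachable (x i) (x j)}; ∃ φ : ℕ → ℕ, StrictMono φ ∧ ∃ (p r : ℕ → ℝ), (∀ i, 0 ≤ p i ∧ p i ≤ 1) ∧ Summable p ∧ (∀ k : ℕ, Filter.Tendsto (fun n : ℕ => (∏ i ∈ Finset.range n, (Polynomial.C (1 - p i) + Polynomial.C (p i) * Polynomial.X)).coeff k) Filter.atTop (nhds (r k))) ∧ ∀ k : ℕ, Filter.Tendsto (fun j : ℕ => (Literature.Probability.Percolation.bondPercolation (Literature.Probability.LatticeModels.zdGraph 2) Literature.Probability.Percolation.half).real (atLeast (s (φ j)) k) - (Literature.Probability.Percolation.bondPercolation (Literature.Probability.LatticeModels.zdGraph 2) Literature.Probability.Percolation.half).real (atLeast (s (φ j)) (k + 1))) Filter.atTop (nhds (r k))) → ∀ P : ℝ → ℝ, (∀ a b : ℝ, 0 < a → 0 < b → Filter.Tendsto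 (fun δ : ℝ => Literature.Probability.Percolation.discreteCrossingProb Literature.Probability.Percolation.half {z : ℂ | 0 < z.re ∧ z.re < a ∧ 0 < z.im ∧ z.im < b} δ {z : ℂ | z.re = 0 ∧ 0 ≤ z.im ∧ z.im ≤ b} {z : ℂ | z.re = a ∧ 0 ≤ z.im ∧ z.im ≤ b}) (nhdsWithin 0 (Set.Ioi 0)) (nhds (P (a / b)))) → (∀ r : ℝ, 0 < r → P (1 / r) = 1 - P r) ∧ ∃ (α : ℝ) (c : ℕ → ℝ), 0 < α ∧ Literature.Probability.RandomPlanarGeometry.KlebanZagier.IsConformalBlock P α c ∧ ∃ C k : ℝ, ∀ n : ℕ, |c n| ≤ C * ((n : ℝ) + 1) ^ k := by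
  sorry

/-- By-name handle of the registered stub `Holds.stub_selfDualBlockPB`. -/
def stub_selfDualBlockPB : Prop := type_of% Holds.stub_selfDualBlockPB

/-- **Stub 3 — the boundary exponent: the block dimension is `1/3` (OPEN; L–XL).** In any
conformal-block representation with `α > 0` of a scaling function `P` of the box crossings, `α = 1/3`,
i.e. `−log P(r) ∼ π r / 3` as `r → ∞` (Cardy 1992: `Π_h(r) ≍ e^{−π r/3}`, the `π h_{1,3}` Kac rate;
in this route `Ψ(0) = −π/3`, `StripClusterRates`). The dimension is intrinsic (leading exponential
rate), so no growth hypothesis is needed. VERBATIM the registered stub `stub_dimension` of item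
stmt-CriticalPhenomena-4782 (`Cruxes/CardyRectangle/Lines/birth.lean`): one proof closes both. -/
protected theorem Holds.stub_boundaryDimension : ∀ P : ℝ → ℝ, (∀ a b : ℝ, 0 < a → 0 < b → Filter.Tendsto (fun δ : ℝ => Literature.Probability.Percolation.discreteCrossingProb Literature.Probability.Percolation.half {z : ℂ | 0 < z.re ∧ z.re < a ∧ 0 < z.im ∧ z.im < b} δ {z : ℂ | z.re = 0 ∧ 0 ≤ z.im ∧ z.im ≤ b} {z : ℂ | z.re = a ∧ 0 ≤ z.im ∧ z.im ≤ b}) (nhdsWithin 0 (Set.Ioi 0)) (nhds (P (a / b)))) → ∀ (α : ℝ) (c : ℕ → ℝ), 0 < α → Literature.Probability.RandomPlanarGeometry.KlebanZagier.IsConformalBlock P α c → α = 1 / 3 := by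
  sorry

/-- By-name handle of the registered stub `Holds.stub_boundaryDimension`. -/
def stub_boundaryDimension : Prop := type_of% Holds.stub_boundaryDimension

/-- **Stub 4 — corner markings: from the identified scaling function to `CardyRectangle` (provable
now; M–L).** If a scaling function `P` of the left-to-right box crossings exists and equals Cardy's
`F(λ(ir))` (`cardyFunction (lamR r)`) for every aspect ratio `r > 0`, then Cardy's formula holds for every
conformal rectangle whose carrier is an open box `(0,a)×(0,b)` and whose marked points are its four
corners (all eight markings): arcs `0`/`2` are opposite closed sides, the modulus is `λ(i·a/b)` for the
vertical pair and `λ(i·b/a)` for the horizontal pair (Kleban–Zagier 2003 §3, "the classical result for the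
cross-ratio"; `rectangle_crossRatio_eq_lamR`, `crossRatio_neg`, `crossRatio_rev`,
`ConformalRectangle.crossRatio_eq_of_isUniformizing`), the bottom-to-top crossing probability of
`(0,a)×(0,b)` equals `LR(b,a,δ)` (transposition automorphism of `ℤ²` through `meshVertices`, `meshGraph`,
`meshDomain`, `discreteArc`, `bondPercolation (zdGraph 2) half`), and `discreteCrossing` is symmetric in
its two arcs. -/
protected theorem Holds.stub_cornerMarkings : ∀ P : ℝ → ℝ, (∀ a b : ℝ, 0 < a → 0 < b → Filter.Tendsto (fun δ : ℝ => Literature.Probability.Percolation.discreteCrossingProb Literature.Probability.Percolation.half {z : ℂ | 0 < z.re ∧ z.re < a ∧ 0 < z.im ∧ z.im < b} δ {z : ℂ | z.re = 0 ∧ 0 ≤ z.im ∧ z.im ≤ b} {z : ℂ | z.re = a ∧ 0 ≤ z.im ∧ z.im ≤ b}) (nhdsWithin 0 (Set.Ioi 0)) (nhds (P (a / b)))) → (∀ r : ℝ, 0 < r → P r = Literature.Probability.RandomPlanarGeometry.cardyFunction (Literature.Probability.RandomPlanarGeometry.KlebanZagier.lamR r)) → Summit.CriticalPhenomena.CardyFormulaZ2.Theses.CardyPolygonWords.CardyRectangle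 := by
  sorry

/-- By-name handle of the registered stub `Holds.stub_cornerMarkings`. -/
def stub_cornerMarkings : Prop := type_of% Holds.stub_cornerMarkings

/-- **Stub 5 — polygons by junctions under `H_PB` (OPEN; XL).** Under `H_PB`, Cardy's formula for
corner-marked rectangles (`CardyRectangle`) implies Cardy's formula for every lattice polygon with lattice
marks (`CardyLatticePolygon`): at aligned meshes the crossing probability of a polyomino is a word in the
stochastic Temperley–Lieb row-transfer matrices of varying width and junction (free-site
insertion/restriction) maps; the rectangle data fix towers and amplitudes, the junction overlaps are the
one new local datum ("corner operators of polygons" in the crux's NOT-DECOMPOSED list), and the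
Poisson-binomial structure of the crossing number is available on every polygon since `H_PB` quantifies
over all conformal rectangles (Bondesan–Jacobsen–Saleur 2012 rectangle amplitudes, arXiv:1207.7005;
Dubail–Stéphan 2011 junction fidelity; the sibling obligation `WordSewing`, stmt-CriticalPhenomena-14409,
trades `H_PB` for the one-step datum `CardyOneStep`). -/
protected theorem Holds.stub_junctionsPB : (∀ (R : Literature.Probability.RandomPlanarGeometry.ConformalRectangle) (s : ℕ → ℝ), (∀ j, 0 < s j) → Filter.Tendsto s Filter.atTop (nhds 0) → let G : ℝ → Literature.Probability.Percolation.BondConfig (Literature.Probability.LatticeModels.Site 2) → SimpleGraph (Literature.Probability.LatticeModels.Site 2) := fun δ ω => Literature.Probability.Percolation.openGraph ω ⊓ Literature.Probability.LatticeModels.discreteDomainGraph R.carrier δ; let atLeast : ℝ → ℕ → Set (Literature.Probability.Percolation.BondConfig (Literature.Probability.LatticeModels.Site 2)) := fun δ k => {ω | ∃ x : Fin k → Literature.Probability.LatticeModels.Site 2, (∀ i, x i ∈ Literature.Probability.LatticeModels.discreteArc R.carrier δ (R.arc 0) ∧ ∃ y ∈ Literature.Probability.LatticeModels.discreteArc R.carrier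 δ (R.arc 2), (G δ ω).Reachable (x i) y) ∧ ∀ i j, i ≠ j → ¬ (G δ ω).Reachable (x i) (x j)}; ∃ φ : ℕ → ℕ, StrictMono φ ∧ ∃ (p r : ℕ → ℝ), (∀ i, 0 ≤ p i ∧ p i ≤ 1) ∧ Summable p ∧ (∀ k : ℕ, Filter.Tendsto (fun n : ℕ => (∏ i ∈ Finset.range n, (Polynomial.C (1 - p i) + Polynomial.C (p i) * Polynomial.X)).coeff k) Filter.atTop (nhds (r k))) ∧ ∀ k : ℕ, Filter.Tendsto (fun j : ℕ => (Literature.Probability.Percolation.bondPercolation (Literature.Probability.LatticeModels.zdGraph 2) Literature.Probability.Percolation.half).real (atLeast (s (φ j)) k) - (Literature.Probability.Percolation.bondPercolation (Literature.Probability.LatticeModels.zdGraph 2) Literature.Probability.Percolation.half).real (atLeast (s (φ j)) (k + 1))) Filter.atTop (nhds (r k))) → Summit.CriticalPhenomena.CardyFormulaZ2.Theses.CardyPolygonWords.CardyRectangle → Summit.CriticalPhenomena.CardyFormulaZ2.Theses.CardyPolygonWords.CardyLatticePolygon := by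
  sorry

/-- By-name handle of the registered stub `Holds.stub_junctionsPB`. -/
def stub_junctionsPB : Prop := type_of% Holds.stub_junctionsPB

/-! ### Sorry-free glue lemma used by the composition -/

/-- `genCardyFunction (1/3) = cardyFunction`: the SLE₆ member of Kleban–Zagier's family `Π_h(·;α)` is
Cardy's function (`Γ(4/3) = Γ(1/3)/3`, so `Γ(2/3)/(Γ(1/3)Γ(4/3)) = 3Γ(2/3)/Γ(1/3)²`). [folklore] -/
theorem genCardyFunction_one_third (η : ℝ) : genCardyFunction (1 / 3) η = cardyFunction η := by
  have hΓ : Real.Gamma (1 + 1 / 3 : ℝ) = 1 / 3 * Real.Gamma (1 / 3) := by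
    rw [add_comm]
    exact Real.Gamma_add_one (by norm_num)
  have hΓ0 : Real.Gamma (1 / 3 : ℝ) ≠ 0 := (Real.Gamma_pos_of_pos (by norm_num)).ne'
  rw [Literature.Probability.RandomPlanarGeometry.KlebanZagier.genCardyFunction,
    Literature.Probability.RandomPlanarGeometry.cardyFunction, hΓ]
  have e1 : (2 : ℝ) * (1 / 3) = 2 / 3 := by norm_num
  have e2 : (1 : ℝ) - 1 / 3 = 2 / 3 := by norm_num
  have e3 : (1 : ℝ) + 1 / 3 = 4 / 3 := by norm_num
  have e4 : Real.Gamma (2 / 3) / (Real.Gamma (1 / 3) * (1 / 3 * Real.Gamma (1 / 3))) =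
      3 * Real.Gamma (2 / 3) / Real.Gamma (1 / 3) ^ 2 := by
    field_simp
  rw [e1, e2, e3, e4]

/-! ### Composition (sorry-free): the five stubs imply the crux BY NAME -/

/-- **`StieltjesIdentification` from the five stubs (real proof).** See the module docstring. -/
theorem StieltjesIdentification_of (hE : stub_scalingLimitPB) (hB : stub_selfDualBlockPB)
    (hα : stub_boundaryDimension) (hG : stub_cornerMarkings) (hJ : stub_junctionsPB) :
    StieltjesIdentification := by
  dsimp only [stub_scalingLimitPB, stub_selfDualBlockPB, stub_boundaryDimension, stub_cornerMarkings,
    stub_junctionsPB] at hE hB hα hG hJ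
  intro hPB R _hR
  -- the scaling function under `H_PB` and its structure
  obtain ⟨P, hP⟩ := hE hPB
  obtain ⟨hdual, α, c, hαpos, hblock, hgr⟩ := hB hPB P hP
  have hthird : α = 1 / 3 := hα P hP α c hαpos hblock
  -- `P 1 = 1/2` (duality) and `P → 0` at `∞` (block of positive dimension): `P` is not constant
  have hone : P 1 = 1 / 2 := by
    have h := hdual 1 one_pos
    rw [div_one] at h
    linarith
  obtain ⟨C, m, hC, hcm⟩ := Literature.Probability.RandomPlanarGeometry.KlebanZagier.polyGrowth_nat hgr
  have hlim : Tendsto P atTop (𝓝 0) :=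
    Literature.Probability.RandomPlanarGeometry.KlebanZagier.tendsto_P_atTop hblock hcm hC hαpos
  have hnc : ∃ r s : ℝ, 0 < r ∧ 0 < s ∧ P r ≠ P s := by
    have hev : ∀ᶠ t in atTop, dist (P t) 0 < 1 / 4 :=
      (Metric.tendsto_nhds.1 hlim) (1 / 4) (by norm_num)
    obtain ⟨t, ht1, ht⟩ := ((eventually_ge_atTop (1 : ℝ)).and hev).exists
    refine ⟨t, 1, by linarith, one_pos, ?_⟩
    rw [hone]
    intro h
    rw [h, Real.dist_eq] at ht
    norm_num at ht
  -- Kleban–Zagier, Theorem 2 (corrected; proved in the tree): `P = Π_h(·;α) ∘ λ(i·)` on `(0,∞)`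
  obtain ⟨-, -, hKZ⟩ :=
    Literature.Probability.RandomPlanarGeometry.KlebanZagier.theorem2_corrected P α c hblock hgr hdual hnc
  have hcardy : ∀ r : ℝ, 0 < r → P r = cardyFunction (lamR r) := by
    intro r hr
    rw [hKZ r hr, hthird, genCardyFunction_one_third,
      Literature.Probability.RandomPlanarGeometry.KlebanZagier.modularLambdaI_eq_lamR hr]
  -- corner-marked rectangles, then lattice polygons by junctions, then every conformal rectangle
  have hRect : CardyRectangle := hG P hP hcardy
  have hLP : CardyLatticePolygon := hJ hPB hRect
  have hZ2 : _root_.CardyFormulaZ2 :=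
    Summit.CriticalPhenomena.CardyFormulaZ2.Theorems.LatticePolygonApproximation.cardyFormulaZ2_of_cardyLatticePolygon
      hLP
  exact hZ2 R

/-- **The crux BY NAME from the five stubs** (depends on `sorryAx` ONLY through the five `Holds.stub_*`;
this line also certifies that the by-name handles ARE the stub statements). -/
theorem StieltjesIdentification_proof : StieltjesIdentification :=
  StieltjesIdentification_of Holds.stub_scalingLimitPB Holds.stub_selfDualBlockPB
    Holds.stub_boundaryDimension Holds.stub_cornerMarkings Holds.stub_junctionsPB

end Summit.CriticalPhenomena.CardyFormulaZ2.Cruxes.StieltjesIdentification.Birth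

end
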